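import Summits.ResolutionOfSingularities.ResolutionOfSingularities.Theorems.PurelyInseparableDim4JetColength
import Summits.ResolutionOfSingularities.ResolutionOfSingularities.Theorems.PurelyInseparableDim4NarrowApolarity
import HarnessLib

/-!
# [OURS · res-dim4-pi] THE WIDE FAT POINT AT FINITE LEVEL — bivariate span lemma, the plane bound
  `dim_K A ⧸ (J + 𝔪₀ᴺ) ≤ N(N+1)/2`, and wide apolarity (CARD I-3-11 §1 of seat idea-3, typed)

Cell `res-dim4-pi` (D-0157 DOOR 2), seat `res-dim4-p-3` (g2); sequel of `…JetColength.lean` (p661642 /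
p661862, the `μ⁺` letter).  idea-3's CARD I-3-11 / memo `iso6/WIDE-STRUCTURE.md` §1 reads the WIDE
isolated floor states (`ord₀ F = q`, ridge `W = A(in F)` of dimension `ē = 2`) as a PLANE FAT POINT
`Z_F = Spec R̂ ⧸ Ĵ_q⁺(F) ≅ Spec K⟦u,v⟧ ⧸ I_F`, with letters `μ⁺ = colength`, `o(F) = ord I_F`, read off the
Hilbert function `N ↦ d_N := dim_K A ⧸ (J_q⁺(F) + 𝔪₀ᴺ)`.  This file is the finite-level, def-free
kernel form of that §1 over the frame's `originIdeal` / `singLocusIdeal` and `RidgeBudget.jetColength`: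

* §1 `originIdeal_le_span_pair_sup` — WIDE APOLARITY: if every ridge vector `u ∈ A(in F)` with
  `u_a = u_b = 0` vanishes (i.e. `(x_a, x_b)` restrict to coordinates on `W`), then
  `𝔪₀ ≤ (x_a, x_b) + J_q⁺(F) + 𝔪₀²` — one line over p-1 g2's dual apolarity
  `NarrowApolarity.originIdeal_le_of_forall_additiveSubspace` (p661824).
* §2 BIVARIATE FILTRATION `originIdeal_pow_le_span_pair_pow_sup`: `𝔪₀ ≤ (x_a, x_b) + J + 𝔪₀²` ⇒
  `𝔪₀ⁿ ≤ (x_aᵏ x_bⁿ⁻ᵏ : k ≤ n) + J + 𝔪₀ⁿ⁺¹`; the `K`-level layers `originIdeal_pow_le_span_range_sup`,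
  `originIdeal_pow_le_span_layers_sup`, and SPANNING `top_le_span_pair_layers_sup`:
  `A = Σ_{k+l<N} K·x_aᵏx_bˡ + (J + 𝔪₀ᴺ)`.
* §3 THE PLANE BOUND `finrank_quotient_le_triangle`: `dim_K A ⧸ (J + 𝔪₀ᴺ) ≤ N(N+1)/2` (the Hilbert
  function of `Z_F` is bounded by that of `K⟦u,v⟧`), via the general
  `finrank_quotient_le_card_of_top_le_span_sup`; `finrank_quotient_sup_pow_one` (`d_1 = 1`).
* §4 `μ⁺`-vocabulary: `jetColength_le_triangle`.

[OURS · counted 0 · elementary commutative/linear algebra; AI kernel work, weaker than expert review.]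
Nothing here is a statement about resolution of singularities; nothing here proves `NoWideTrap` /
`E2(3,3)`; resolution in dimension `≥ 4` / characteristic `p > 0` is NOT proved by anything in this
file.  Host item (DR-157-C): `stmt-ResolutionOfSingularities-16155`, helper.
-/

noncomputable section

set_option linter.dupNamespace false -- mandated namespace of this single-conjunct summit

open MvPolynomial Finset
open scoped BigOperators

namespace Summit.ResolutionOfSingularities.ResolutionOfSingularities.Theorems.PIDim4.RidgeBudget

open IsolationCert
open Literature.AlgebraicGeometry.Resolution
open Literature.AlgebraicGeometry.Resolution.Hauser2010
open Literature.AlgebraicGeometry.Resolution.HauserPerlega2019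
open Literature.Barriers.ResolutionOfSingularities
open PointBlowup (gradSpan additiveSubspace)

variable {K : Type} [Field K]

/-! ## §1 Wide apolarity -/

/-- **WIDE APOLARITY.** At a point of order exactly `q ≥ 2`: if every ridge vector `u ∈ A(in F)`
with `u_a = u_b = 0` is `0` (the coordinates `x_a, x_b` restrict to coordinates on the ridge `W`;
for `ē = dim_K W ≤ 2` some pair always qualifies), then `𝔪₀ ≤ (x_a, x_b) + J_q⁺(F) + 𝔪₀²`: every
linear form is a combination of `x_a, x_b` plus the linear part of an element of `J_q⁺(F)` — the
local algebra of the Hasse fat point has embedding dimension `≤ 2` with `x_a, x_b` as residual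
coordinates. OURS (one line over `NarrowApolarity.originIdeal_le_of_forall_additiveSubspace`).
[cite: BerthomieuHivertMourtada2010, Cor. 2.3] -/
theorem originIdeal_le_span_pair_sup {q : ℕ} (hq : 2 ≤ q) {F : MvPolynomial (Fin 4) K}
    (hord : ordZero F = q) {a b : Fin 4}
    (h : ∀ u ∈ additiveSubspace (initialForm F), u a = 0 → u b = 0 → u = 0) :
    originIdeal K ≤ Ideal.span {(X a : MvPolynomial (Fin 4) K), X b} ⊔ singLocusIdeal q F ⊔
      originIdeal K ^ 2 := by
  refine NarrowApolarity.originIdeal_le_of_forall_additiveSubspace hq hord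
    (I := Ideal.span {(X a : MvPolynomial (Fin 4) K), X b} ⊔ singLocusIdeal q F ⊔ originIdeal K ^ 2)
    (by rw [sup_assoc]; exact le_sup_right) fun u hu hui => ?_
  exact h u hu
    (hui a (Ideal.mem_sup_left (Ideal.mem_sup_left (Ideal.subset_span (Set.mem_insert _ _)))))
    (hui b (Ideal.mem_sup_left (Ideal.mem_sup_left
      (Ideal.subset_span (Set.mem_insert_of_mem _ rfl)))))

/-! ## §2 The bivariate `𝔪₀`-filtration and spanning -/

/-- `x_aᵏ x_bᵈ⁻ᵏ ∈ 𝔪₀ᵈ` for `k ≤ d`. OURS (bookkeeping). [cite: AtiyahMacdonald1969, Ch. 1 Ex. 1.1 (the ideal (x₁,…,xₙ))] -/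
theorem X_pow_mul_X_pow_mem_originIdeal_pow (a b : Fin 4) {d k : ℕ} (hk : k ≤ d) :
    (X a : MvPolynomial (Fin 4) K) ^ k * X b ^ (d - k) ∈ originIdeal K ^ d := by
  have h := Ideal.mul_mem_mul (Ideal.pow_mem_pow (IsolatedScope.X_mem_originIdeal (K := K) a) k)
    (Ideal.pow_mem_pow (IsolatedScope.X_mem_originIdeal (K := K) b) (d - k))
  rwa [← pow_add, Nat.add_sub_cancel' hk] at h

/-- The degree-`n` generators `x_aᵏ x_bⁿ⁻ᵏ` span an ideal inside `𝔪₀ⁿ`. OURS (bookkeeping).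
[cite: AtiyahMacdonald1969, Ch. 1 Ex. 1.1 (the ideal (x₁,…,xₙ))] -/
theorem span_range_pair_pow_le_originIdeal_pow (a b : Fin 4) (n : ℕ) :
    Ideal.span (Set.range fun k : Fin (n + 1) =>
        (X a : MvPolynomial (Fin 4) K) ^ (k : ℕ) * X b ^ (n - (k : ℕ))) ≤ originIdeal K ^ n := by
  refine Ideal.span_le.mpr ?_
  rintro _ ⟨k, rfl⟩
  exact X_pow_mul_X_pow_mem_originIdeal_pow a b (Nat.lt_succ_iff.mp k.is_lt)

/-- `(x_a, x_b) · (x_aᵏ x_bⁿ⁻ᵏ : k ≤ n) ≤ (x_aᵏ x_bⁿ⁺¹⁻ᵏ : k ≤ n + 1)`. OURS (bookkeeping).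
[cite: AtiyahMacdonald1969, Ch. 1 (operations on ideals)] -/
theorem span_pair_mul_span_range_le (a b : Fin 4) (n : ℕ) :
    Ideal.span {(X a : MvPolynomial (Fin 4) K), X b} *
        Ideal.span (Set.range fun k : Fin (n + 1) =>
          (X a : MvPolynomial (Fin 4) K) ^ (k : ℕ) * X b ^ (n - (k : ℕ))) ≤
      Ideal.span (Set.range fun k : Fin (n + 1 + 1) =>
        (X a : MvPolynomial (Fin 4) K) ^ (k : ℕ) * X b ^ (n + 1 - (k : ℕ))) := by
  rw [Ideal.span_mul_span']
  refine Ideal.span_le.mpr ?_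
  rintro _ ⟨s, hs, t, ⟨k, rfl⟩, rfl⟩
  have hk : (k : ℕ) ≤ n := Nat.lt_succ_iff.mp k.is_lt
  rcases hs with rfl | rfl
  · refine Ideal.subset_span ⟨⟨(k : ℕ) + 1, by omega⟩, ?_⟩
    show (X a : MvPolynomial (Fin 4) K) ^ ((k : ℕ) + 1) * X b ^ (n + 1 - ((k : ℕ) + 1)) =
      X a * (X a ^ (k : ℕ) * X b ^ (n - (k : ℕ)))
    rw [Nat.add_sub_add_right]
    ring
  · refine Ideal.subset_span ⟨⟨(k : ℕ), by omega⟩, ?_⟩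
    show (X a : MvPolynomial (Fin 4) K) ^ (k : ℕ) * X b ^ (n + 1 - (k : ℕ)) =
      X b * (X a ^ (k : ℕ) * X b ^ (n - (k : ℕ)))
    rw [Nat.sub_add_comm hk]
    ring

/-- **Bivariate filtration step.** `𝔪₀ ≤ (x_a, x_b) + J + 𝔪₀²` gives, for every `n`,
`𝔪₀ⁿ ≤ (x_aᵏ x_bⁿ⁻ᵏ : k ≤ n) + J + 𝔪₀ⁿ⁺¹`. OURS (elementary).
[cite: AtiyahMacdonald1969, Prop. 2.6 / Cor. 2.7 (Nakayama's lemma)] -/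
theorem originIdeal_pow_le_span_pair_pow_sup {J : Ideal (MvPolynomial (Fin 4) K)} {a b : Fin 4}
    (hm : originIdeal K ≤ Ideal.span {(X a : MvPolynomial (Fin 4) K), X b} ⊔ J ⊔ originIdeal K ^ 2)
    (n : ℕ) :
    originIdeal K ^ n ≤
      Ideal.span (Set.range fun k : Fin (n + 1) =>
          (X a : MvPolynomial (Fin 4) K) ^ (k : ℕ) * X b ^ (n - (k : ℕ))) ⊔ J ⊔
        originIdeal K ^ (n + 1) := by
  induction n with
  | zero =>
    rw [pow_zero, Ideal.one_eq_top, top_le_iff, Ideal.eq_top_iff_one]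
    exact Ideal.mem_sup_left (Ideal.mem_sup_left (Ideal.subset_span ⟨0, by simp⟩))
  | succ n ih =>
    have h1 : originIdeal K * Ideal.span (Set.range fun k : Fin (n + 1) =>
          (X a : MvPolynomial (Fin 4) K) ^ (k : ℕ) * X b ^ (n - (k : ℕ))) ≤
        Ideal.span (Set.range fun k : Fin (n + 1 + 1) =>
            (X a : MvPolynomial (Fin 4) K) ^ (k : ℕ) * X b ^ (n + 1 - (k : ℕ))) ⊔ J ⊔
          originIdeal K ^ (n + 1 + 1) := by
      refine (Ideal.mul_mono_left hm).trans ?_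
      rw [Ideal.sup_mul, Ideal.sup_mul]
      refine sup_le (sup_le ((span_pair_mul_span_range_le a b n).trans (le_sup_left.trans le_sup_left))
        (Ideal.mul_le_right.trans (le_sup_right.trans le_sup_left))) ?_
      refine (Ideal.mul_mono_right (span_range_pair_pow_le_originIdeal_pow a b n)).trans ?_
      rw [← pow_add, show 2 + n = n + 1 + 1 by ring]
      exact le_sup_right
    calc originIdeal K ^ (n + 1) = originIdeal K * originIdeal K ^ n := pow_succ' _ n
      _ ≤ originIdeal K * (Ideal.span (Set.range fun k : Fin (n + 1) =>
            (X a : MvPolynomial (Fin 4) K) ^ (k : ℕ) * X b ^ (n - (k : ℕ))) ⊔ J ⊔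
            originIdeal K ^ (n + 1)) := Ideal.mul_mono_right ih
      _ = originIdeal K * Ideal.span (Set.range fun k : Fin (n + 1) =>
            (X a : MvPolynomial (Fin 4) K) ^ (k : ℕ) * X b ^ (n - (k : ℕ))) ⊔ originIdeal K * J ⊔
            originIdeal K * originIdeal K ^ (n + 1) := by rw [Ideal.mul_sup, Ideal.mul_sup]
      _ ≤ _ := by
          refine sup_le (sup_le h1 ?_) ?_
          · exact Ideal.mul_le_left.trans (le_sup_right.trans le_sup_left)
          · rw [← pow_succ']
            exact le_sup_right

/-- **One layer, `K`-level.** Under `𝔪₀ ≤ (x_a, x_b) + J + 𝔪₀²`: every element of `𝔪₀ⁿ` is a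
`K`-combination of the `x_aᵏ x_bⁿ⁻ᵏ` plus an element of `J + 𝔪₀ⁿ⁺¹` (coefficients reduced to their
constant terms). OURS (elementary). [cite: AtiyahMacdonald1969, Prop. 2.6 / Cor. 2.7 (Nakayama's lemma)] -/
theorem originIdeal_pow_le_span_range_sup {J : Ideal (MvPolynomial (Fin 4) K)} {a b : Fin 4}
    (hm : originIdeal K ≤ Ideal.span {(X a : MvPolynomial (Fin 4) K), X b} ⊔ J ⊔ originIdeal K ^ 2)
    (n : ℕ) :
    (originIdeal K ^ n).restrictScalars K ≤
      Submodule.span K (Set.range fun k : Fin (n + 1) =>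
          (X a : MvPolynomial (Fin 4) K) ^ (k : ℕ) * X b ^ (n - (k : ℕ))) ⊔
        (J ⊔ originIdeal K ^ (n + 1)).restrictScalars K := by
  intro m hm0
  rw [Submodule.restrictScalars_mem] at hm0
  obtain ⟨qj, hqj, m', hm', rfl⟩ :=
    Submodule.mem_sup.mp (originIdeal_pow_le_span_pair_pow_sup hm n hm0)
  obtain ⟨q, hq, j, hj, rfl⟩ := Submodule.mem_sup.mp hqj
  obtain ⟨c, hc⟩ := Ideal.mem_span_range_iff_exists_fun.mp hq
  have hsplit : q = (∑ k : Fin (n + 1), C (constantCoeff (c k)) *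
        ((X a : MvPolynomial (Fin 4) K) ^ (k : ℕ) * X b ^ (n - (k : ℕ)))) +
      ∑ k : Fin (n + 1), (c k - C (constantCoeff (c k))) *
        ((X a : MvPolynomial (Fin 4) K) ^ (k : ℕ) * X b ^ (n - (k : ℕ))) := by
    rw [← hc, ← Finset.sum_add_distrib]
    exact Finset.sum_congr rfl fun k _ => by ring
  rw [hsplit, add_assoc, add_assoc]
  refine Submodule.add_mem _ (Submodule.mem_sup_left ?_) (Submodule.mem_sup_right ?_)
  · exact Submodule.sum_mem _ fun k _ => by
      rw [← smul_eq_C_mul]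
      exact Submodule.smul_mem _ _ (Submodule.subset_span ⟨k, rfl⟩)
  · rw [Submodule.restrictScalars_mem]
    refine Submodule.add_mem _ (Submodule.mem_sup_right (Ideal.sum_mem _ fun k _ => ?_))
      (Submodule.add_mem _ (Submodule.mem_sup_left hj) (Submodule.mem_sup_right hm'))
    rw [pow_succ']
    exact Ideal.mul_mem_mul (sub_C_constantCoeff_mem_originIdeal _)
      (X_pow_mul_X_pow_mem_originIdeal_pow a b (Nat.lt_succ_iff.mp k.is_lt))

/-- **Layers `i ≤ d < k`, `K`-level.** Under `𝔪₀ ≤ (x_a, x_b) + J + 𝔪₀²`: `𝔪₀ⁱ` lies in the `K`-span of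
the monomials `x_aᵏ x_bˡ` with `i ≤ k + l < k₀` plus `J + 𝔪₀^{k₀}`, for every `i ≤ k₀`. OURS (elementary).
[cite: AtiyahMacdonald1969, Prop. 2.6 / Cor. 2.7 (Nakayama's lemma)] -/
theorem originIdeal_pow_le_span_layers_sup {J : Ideal (MvPolynomial (Fin 4) K)} {a b : Fin 4}
    (hm : originIdeal K ≤ Ideal.span {(X a : MvPolynomial (Fin 4) K), X b} ⊔ J ⊔ originIdeal K ^ 2)
    {i k₀ : ℕ} (hik : i ≤ k₀) :
    (originIdeal K ^ i).restrictScalars K ≤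
      Submodule.span K (⋃ d ∈ Set.Ico i k₀, Set.range fun k : Fin (d + 1) =>
          (X a : MvPolynomial (Fin 4) K) ^ (k : ℕ) * X b ^ (d - (k : ℕ))) ⊔
        (J ⊔ originIdeal K ^ k₀).restrictScalars K := by
  induction k₀, hik using Nat.le_induction with
  | base =>
    intro x hx
    refine Submodule.mem_sup_right ?_
    rw [Submodule.restrictScalars_mem] at hx ⊢
    exact Submodule.mem_sup_right hx
  | succ k₀ hik ih =>
    refine ih.trans (sup_le ?_ ?_)
    · refine (Submodule.span_mono ?_).trans le_sup_left
      exact Set.biUnion_subset_biUnion_left fun d hd =>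
        ⟨hd.1, hd.2.trans (Nat.lt_succ_self k₀)⟩
    · intro x hx
      rw [Submodule.restrictScalars_mem] at hx
      obtain ⟨j, hj, m, hm0, rfl⟩ := Submodule.mem_sup.mp hx
      have hm1 := originIdeal_pow_le_span_range_sup hm k₀
        ((Submodule.restrictScalars_mem K _ _).mpr hm0)
      obtain ⟨s, hs, t, ht, rfl⟩ := Submodule.mem_sup.mp hm1
      rw [Submodule.restrictScalars_mem] at ht
      rw [← add_assoc, add_comm j s, add_assoc]
      refine Submodule.add_mem _ (Submodule.mem_sup_left (Submodule.span_mono ?_ hs))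
        (Submodule.mem_sup_right ?_)
      · exact Set.subset_biUnion_of_mem (u := fun d => Set.range fun k : Fin (d + 1) =>
          (X a : MvPolynomial (Fin 4) K) ^ (k : ℕ) * X b ^ (d - (k : ℕ)))
          (Set.mem_Ico.mpr ⟨hik, Nat.lt_succ_self k₀⟩)
      · rw [Submodule.restrictScalars_mem]
        exact Submodule.add_mem _ (Submodule.mem_sup_left hj) ht

/-- **Bivariate spanning.** Under `𝔪₀ ≤ (x_a, x_b) + J + 𝔪₀²`, for every `N`:
`A = Σ_{k+l<N} K·x_aᵏ x_bˡ + (J + 𝔪₀ᴺ)` — the quotient `A ⧸ (J + 𝔪₀ᴺ)` is spanned by the classes of the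
monomials in `x_a, x_b` of degree `< N` (the fat point lives in the `(x_a, x_b)`-plane). OURS (elementary).
[cite: AtiyahMacdonald1969, Prop. 2.6 / Cor. 2.7 (Nakayama's lemma)] -/
theorem top_le_span_pair_layers_sup {J : Ideal (MvPolynomial (Fin 4) K)} {a b : Fin 4}
    (hm : originIdeal K ≤ Ideal.span {(X a : MvPolynomial (Fin 4) K), X b} ⊔ J ⊔ originIdeal K ^ 2)
    (N : ℕ) :
    (⊤ : Submodule K (MvPolynomial (Fin 4) K)) ≤
      Submodule.span K (⋃ d ∈ Set.Ico 0 N, Set.range fun k : Fin (d + 1) =>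
          (X a : MvPolynomial (Fin 4) K) ^ (k : ℕ) * X b ^ (d - (k : ℕ))) ⊔
        (J ⊔ originIdeal K ^ N).restrictScalars K := by
  intro x _
  refine originIdeal_pow_le_span_layers_sup hm (Nat.zero_le N) ?_
  rw [Submodule.restrictScalars_mem, pow_zero, Ideal.one_eq_top]
  exact Submodule.mem_top

/-! ## §3 The plane bound `d_N ≤ N(N+1)/2` -/

/-- A quotient `A ⧸ I` whose classes of a finite family `v` span it has `dim_K ≤ card ι`. OURS
(linear algebra; the `Fin k` case is `finrank_quotient_le_of_top_le_span_sup`).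
[cite: AtiyahMacdonald1969, Prop. 6.9 (length is additive)] -/
theorem finrank_quotient_le_card_of_top_le_span_sup {ι : Type} [Fintype ι]
    {I : Ideal (MvPolynomial (Fin 4) K)} (v : ι → MvPolynomial (Fin 4) K)
    (h : (⊤ : Submodule K (MvPolynomial (Fin 4) K)) ≤
      Submodule.span K (Set.range v) ⊔ I.restrictScalars K) :
    Module.finrank K (MvPolynomial (Fin 4) K ⧸ I) ≤ Fintype.card ι := by
  have hf : Function.Surjective
      ((Ideal.Quotient.mkₐ K I).toLinearMap ∘ₗ Fintype.linearCombination K v) := by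
    intro x
    obtain ⟨g, rfl⟩ := Ideal.Quotient.mkₐ_surjective K I x
    obtain ⟨s, hs, t, ht, hst⟩ := Submodule.mem_sup.mp (h (Submodule.mem_top : g ∈ ⊤))
    rw [← Fintype.range_linearCombination, LinearMap.mem_range] at hs
    obtain ⟨c, hc⟩ := hs
    rw [Submodule.restrictScalars_mem] at ht
    refine ⟨c, ?_⟩
    change Ideal.Quotient.mk I (Fintype.linearCombination K v c) = Ideal.Quotient.mk I g
    rw [← hst, hc, map_add, Ideal.Quotient.eq_zero_iff_mem.mpr ht, add_zero]
  calc Module.finrank K (MvPolynomial (Fin 4) K ⧸ I)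
      = Module.finrank K (⊤ : Submodule K (MvPolynomial (Fin 4) K ⧸ I)) := (finrank_top K _).symm
    _ = Module.finrank K (LinearMap.range
          ((Ideal.Quotient.mkₐ K I).toLinearMap ∘ₗ Fintype.linearCombination K v)) := by
        rw [LinearMap.range_eq_top.mpr hf]
    _ ≤ Module.finrank K (ι → K) := LinearMap.finrank_range_le _
    _ = Fintype.card ι := Module.finrank_fintype_fun_eq_card K

/-- The monomials `x_aᵏ x_bˡ`, `k + l < N`, as ONE family indexed by `Σ d : Fin N, Fin (d + 1)`
(total degree `d`, exponent `k` of `x_a`): its range is the union of the degree layers. OURS (bookkeeping).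
[cite: AtiyahMacdonald1969, Ch. 1 Ex. 1.1 (the ideal (x₁,…,xₙ))] -/
theorem range_sigma_pair_pow_eq (a b : Fin 4) (N : ℕ) :
    Set.range (fun σ : (Σ d : Fin N, Fin ((d : ℕ) + 1)) =>
        (X a : MvPolynomial (Fin 4) K) ^ (σ.2 : ℕ) * X b ^ ((σ.1 : ℕ) - (σ.2 : ℕ))) =
      ⋃ d ∈ Set.Ico 0 N, Set.range fun k : Fin (d + 1) =>
        (X a : MvPolynomial (Fin 4) K) ^ (k : ℕ) * X b ^ (d - (k : ℕ)) := by
  ext x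
  simp only [Set.mem_range, Set.mem_iUnion, Set.mem_Ico, Nat.zero_le, true_and, Sigma.exists,
    exists_prop]
  constructor
  · rintro ⟨d, k, rfl⟩
    exact ⟨d, d.is_lt, k, rfl⟩
  · rintro ⟨d, hd, k, rfl⟩
    exact ⟨⟨d, hd⟩, k, rfl⟩

/-- `card (Σ d : Fin N, Fin (d + 1)) = Σ_{d<N} (d + 1)`. OURS (bookkeeping). [folklore] -/
theorem card_sigma_fin_succ (N : ℕ) :
    Fintype.card (Σ d : Fin N, Fin ((d : ℕ) + 1)) = ∑ d ∈ Finset.range N, (d + 1) := by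
  rw [Fintype.card_sigma]
  simp only [Fintype.card_fin]
  exact Fin.sum_univ_eq_sum_range (fun d => d + 1) N

/-- `Σ_{d<N} (d + 1) = N(N+1)/2`. OURS (bookkeeping). [folklore] -/
theorem sum_range_succ_eq_triangle (N : ℕ) : ∑ d ∈ Finset.range N, (d + 1) = N * (N + 1) / 2 := by
  induction N with
  | zero => simp
  | succ N ih =>
    rw [Finset.sum_range_succ, ih, show (N + 1) * (N + 1 + 1) = N * (N + 1) + (N + 1) * 2 by ring,
      Nat.add_mul_div_right _ _ two_pos]

/-- **THE PLANE BOUND.** Under `𝔪₀ ≤ (x_a, x_b) + J + 𝔪₀²`: `dim_K A ⧸ (J + 𝔪₀ᴺ) ≤ N(N+1)/2` for every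
`N` — the Hilbert function of the fat point `A ⧸ (J + 𝔪₀^∞)` is bounded by that of the plane
`K⟦x_a, x_b⟧`. OURS (elementary). [cite: AtiyahMacdonald1969, Prop. 6.9 (length is additive)] -/
theorem finrank_quotient_le_triangle {J : Ideal (MvPolynomial (Fin 4) K)} {a b : Fin 4}
    (hm : originIdeal K ≤ Ideal.span {(X a : MvPolynomial (Fin 4) K), X b} ⊔ J ⊔ originIdeal K ^ 2)
    (N : ℕ) :
    Module.finrank K (MvPolynomial (Fin 4) K ⧸ (J ⊔ originIdeal K ^ N)) ≤ N * (N + 1) / 2 := by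
  have h := finrank_quotient_le_card_of_top_le_span_sup
    (I := J ⊔ originIdeal K ^ N)
    (fun σ : (Σ d : Fin N, Fin ((d : ℕ) + 1)) =>
      (X a : MvPolynomial (Fin 4) K) ^ (σ.2 : ℕ) * X b ^ ((σ.1 : ℕ) - (σ.2 : ℕ)))
    (by rw [range_sigma_pair_pow_eq]; exact top_le_span_pair_layers_sup hm N)
  rwa [card_sigma_fin_succ, sum_range_succ_eq_triangle] at h

/-- `d_1 = 1`: for `J ≤ 𝔪₀`, `dim_K A ⧸ (J + 𝔪₀) = 1` (the residue field). OURS (bookkeeping).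
[cite: AtiyahMacdonald1969, Ch. 1 Ex. 1.1 (the ideal (x₁,…,xₙ))] -/
theorem finrank_quotient_sup_pow_one {J : Ideal (MvPolynomial (Fin 4) K)} (hJ : J ≤ originIdeal K) :
    Module.finrank K (MvPolynomial (Fin 4) K ⧸ (J ⊔ originIdeal K ^ 1)) = 1 := by
  refine le_antisymm ?_ (le_finrank_of_forall_not_certificate J 1 fun k hk h => ?_)
  · refine finrank_quotient_le_of_top_le_span_sup (fun _ : Fin 1 => (1 : MvPolynomial (Fin 4) K))
      fun g _ => ?_
    have hg : g = C (constantCoeff g) + (g - C (constantCoeff g)) := by ring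
    rw [hg]
    refine Submodule.add_mem _ (Submodule.mem_sup_left ?_) (Submodule.mem_sup_right ?_)
    · rw [show C (constantCoeff g) = constantCoeff g • (1 : MvPolynomial (Fin 4) K) by
        rw [smul_eq_C_mul, mul_one]]
      exact Submodule.smul_mem _ _ (Submodule.subset_span ⟨0, rfl⟩)
    · rw [Submodule.restrictScalars_mem, pow_one]
      exact Submodule.mem_sup_right (sub_C_constantCoeff_mem_originIdeal g)
  · interval_cases k
    rw [pow_zero, Ideal.one_eq_top, zero_add, pow_one, sup_eq_right.mpr hJ, top_le_iff] at h
    exact originIdeal_ne_top K h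

/-! ## §4 In `μ⁺`-vocabulary -/

/-- **`μ⁺ ≤ N(N+1)/2` at every level for states whose Hasse fat point is planar**:
`𝔪₀ ≤ (x_a, x_b) + J_q⁺(F) + 𝔪₀²` (e.g. from `originIdeal_le_span_pair_sup` at `ē ≤ 2`) gives
`jetColength q N F ≤ N(N+1)/2`. OURS (elementary). [cite: AtiyahMacdonald1969, Prop. 6.9 (length is additive)] -/
theorem jetColength_le_triangle {q N : ℕ} {F : MvPolynomial (Fin 4) K} {a b : Fin 4}
    (hm : originIdeal K ≤ Ideal.span {(X a : MvPolynomial (Fin 4) K), X b} ⊔ singLocusIdeal q F ⊔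
      originIdeal K ^ 2) :
    jetColength q N F ≤ N * (N + 1) / 2 :=
  finrank_quotient_le_triangle hm N

/-- **Wide floor states have planar fat points**: at order exactly `q ≥ 2`, a coordinate pair
`(x_a, x_b)` separating the ridge (`u ∈ A(in F)`, `u_a = u_b = 0 ⇒ u = 0`) bounds `μ⁺` read at any
level: `jetColength q N F ≤ N(N+1)/2`. OURS (elementary). [cite: AtiyahMacdonald1969, Prop. 6.9 (length is additive)] -/
theorem jetColength_le_triangle_of_additiveSubspace {q N : ℕ} (hq : 2 ≤ q)
    {F : MvPolynomial (Fin 4) K} (hord : ordZero F = q) {a b : Fin 4}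
    (h : ∀ u ∈ additiveSubspace (initialForm F), u a = 0 → u b = 0 → u = 0) :
    jetColength q N F ≤ N * (N + 1) / 2 :=
  finrank_quotient_le_triangle (originIdeal_le_span_pair_sup hq hord h) N

end Summit.ResolutionOfSingularities.ResolutionOfSingularities.Theorems.PIDim4.RidgeBudget

end
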